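import Summits.AtomisticToContinuum.HydrodynamicLimit.Theorems.TwoClocksEquilibriumFastWindowLDBirthT12GainDipole
import HarnessLib

/-!
# (e-K₂) on the DIPOLE sector, II: the true gain term on dipole fields `u(x) = ⟪a, x⟫ Θ(‖x‖)` against its
# Lorentz limit for `Θ` merely measurable and bounded — absolute error `O(m ‖a‖ (1 + ‖v‖))`
# (helper `t12_gainTerm_dipole_sub_lorentz` of the line `birth`, crux `TwoClocks.EquilibriumFastWindowLD`,
# stmt-AtomisticToContinuum-14440; infrastructure (e-K₂), `ℓ = 1`, towards the registered analytic sub-goal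
# `t12_logLinearPreimage_and_dipoleModulus`, plan §5)

Continuation of `…T12GainDipole`, where the law comparison was reduced to one dimension:
`gainTerm u v - lorentzGain u v = 4π ⟪a, n⟫ ∫ γ(dt) (J(t) - J(0))`, `γ = gaussianReal 0 1`, `v = S n`,
`J(t) = ∫_{-1}^{1} (S x - t)₊ (S - (S x - t) x) Θ_t(x) dx`, `Θ_t(x) := Θ(√(S² - (S x)² + t²))`. Here the one-dimensional
estimate is carried out WITHOUT any regularity of `Θ` (measurable, `|Θ| ≤ m` on `[0, ∞)`), along the decomposition
`J(t) - J(0) = ∫ g_t + S ∫ (S x)₊ (Θ_t - Θ₀) - ∫ (S x)₊ x (S x) (Θ_t - Θ₀)`: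

* the two FLUX SHIFTS `g_t = S ((S x - t)₊ - (S x)₊) Θ_t - x ((S x - t)₊ (S x - t) - (S x)₊ (S x)) Θ_t` are
  `O(|t| m (3S + |t|))` pointwise (`x ↦ x₊` is `1`-Lipschitz, `x₊ x = x₊²`, `abs_posPart_mul_sub_le`);
* the RADIAL SPEED SHIFT `∫ (S x)₊ (Θ_t - Θ₀)` is the one of `…T12GainRadialGeneralB` (`abs_integral_speedShift_le`,
  substitution `y = S² - (S x)² + t²`: an `O(t²)`-displacement of the window `[0, S²]`), times `S`;
* the CUBIC SPEED SHIFT (`abs_integral_cubicSpeedShift_le`): by the same substitution, `(S x)² = S² + t² - y`,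
  `∫₀¹ S x (S x)² Θ_t dx = (2S)⁻¹ ∫_{t²}^{S²+t²} (S² + t² - y) Θ(√y) dy`, so the difference with `t = 0` is
  `(2S²)⁻¹ (t² ∫_{t²}^{S²+t²} Θ(√y) dy + (∫_{S²}^{S²+t²} - ∫₀^{t²}) (S² - y) Θ(√y) dy) = O(m (t² + t⁴))` — a weight defect
  `t²` on the bulk and two windows of length `t²`;
* together (`abs_dipoleSlice_sub_zero_le`): `|J(t) - J(0)| ≤ m ((2 + 4S) + 7S|t| + (3 + (3/2)S) t² + S|t|³ + t⁴)`, and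
  with `∫ t² dγ = 1`, `∫ t⁴ dγ = 3`, `|⟪a, n⟫| ≤ ‖a‖`: the registered **`t12_gainTerm_dipole_sub_lorentz`:
  `|gainTerm u v - lorentzGain u v| ≤ 2π m ‖a‖ (16 + 29‖v‖)`** for ALL measurable bounded amplitudes `Θ` — relative
  error `O(1/‖v‖)` against the main terms `≍ m ‖a‖ ‖v‖²`, the order consumed by (e-K₂) on the `ℓ = 1` sector.

[folklore] (Carleman 1933 / Hilbert 1912; Grad 1963 §4; Cercignani–Illner–Pulvirenti 1994 §7.2; plan of the line `birth`).
-/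

noncomputable section

open MeasureTheory ProbabilityTheory Real Set Filter Metric
open scoped ENNReal BigOperators InnerProductSpace
namespace Summit.AtomisticToContinuum.HydrodynamicLimit.Theorems.ClampedCorrectorBirth

open Literature.Analysis.FluidPDE Literature.MathematicalPhysics.KineticTheory
open Literature.Analysis.UnboundedOperators Literature.Probability.Distributions

variable {Θ : ℝ → ℝ} {m : ℝ}

/-! ### One-dimensional preliminaries -/

/-- `|(y - t)₊ (y - t) - y₊ y| ≤ |t| (2|y| + |t|)` (`y₊ y = y₊²`, difference of squares). [folklore] -/
theorem abs_posPart_mul_sub_le (y t : ℝ) : |max (y - t) 0 * (y - t) - max y 0 * y| ≤ |t| * (2 * |y| + |t|) := by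
  have e1 : ∀ z : ℝ, max z 0 * z = max z 0 * max z 0 := fun z => by
    rcases le_total z 0 with h | h
    · rw [max_eq_right h, zero_mul, zero_mul]
    · rw [max_eq_left h]
  have h1 : max (y - t) 0 * (y - t) - max y 0 * y = (max (y - t) 0 - max y 0) * (max (y - t) 0 + max y 0) := by
    rw [e1, e1]; ring
  rw [h1, abs_mul]
  refine mul_le_mul ?_ ?_ (abs_nonneg _) (abs_nonneg _)
  · have h := abs_max_sub_max_le_abs (y - t) y 0
    rwa [show y - t - y = -t by ring, abs_neg] at h
  · rw [abs_of_nonneg (by positivity)]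
    have h2 : max (y - t) 0 ≤ |y| + |t| := max_le (by linarith [le_abs_self y, neg_abs_le t]) (by positivity)
    have h3 : max y 0 ≤ |y| := max_le (le_abs_self y) (abs_nonneg y)
    linarith

/-! ### The speed shift with the cubic weight: substitution `y = S² - (S x)² + t²` -/

/-- `y ↦ (c - y) Θ(√y)` is interval integrable on every `[a, b]` for `Θ` measurable and bounded on `[0, ∞)`. [folklore] -/
theorem intervalIntegrable_sub_mul_comp_sqrt (hΘ : Measurable Θ) (hm : ∀ t : ℝ, 0 ≤ t → |Θ t| ≤ m) (c a b : ℝ) :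
    IntervalIntegrable (fun y => (c - y) * Θ (√y)) volume a b := by
  have hm0 : 0 ≤ m := (abs_nonneg _).trans (hm 0 le_rfl)
  refine intervalIntegrable_of_abs_le (by fun_prop) (C := (|c| + (|a| + |b|)) * m) fun y hy => ?_
  have hy' : |y| ≤ |a| + |b| := by
    rcases mem_uIoc.1 hy with h | h
    · exact abs_le.2 ⟨by linarith [neg_abs_le a, abs_nonneg b], h.2.trans ((le_abs_self b).trans (by linarith [abs_nonneg a]))⟩
    · exact abs_le.2 ⟨by linarith [neg_abs_le b, abs_nonneg a], h.2.trans ((le_abs_self a).trans (by linarith [abs_nonneg b]))⟩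
  rw [abs_mul]
  exact mul_le_mul ((abs_sub _ _).trans (by linarith)) (hm _ (sqrt_nonneg _)) (abs_nonneg _) (by positivity)

/-- **The speed shift with the cubic weight**: for `Θ` measurable with `|Θ| ≤ m` on `[0, ∞)`, `0 ≤ S` and every `t`,
`|∫₀¹ S x · x (S x) (Θ(√(S² - (S x)² + t²)) - Θ(√(S² - (S x)²))) dx| ≤ m (2 + t² + t⁴)`. For `S ≥ 1` the substitution
`y = S² - (S x)² + t²` (`(S x)² = S² + t² - y`) exhibits the two terms as `(2S²)⁻¹ ∫_{t²}^{S²+t²} (S² + t² - y) Θ(√y) dy`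
and `(2S²)⁻¹ ∫₀^{S²} (S² - y) Θ(√y) dy`: difference `(2S²)⁻¹ (t² ∫_{t²}^{S²+t²} Θ(√y) + (∫_{S²}^{S²+t²} - ∫₀^{t²}) (S² - y) Θ(√y))`
`= O(m (t² + t⁴/S²))` (a weight defect `t²` on the bulk, two windows of length `t²`); for `S ≤ 1` the trivial bound
`2 m S²` suffices. No regularity of `Θ` is involved. [folklore] -/
theorem abs_integral_cubicSpeedShift_le (hΘ : Measurable Θ) (hm : ∀ t : ℝ, 0 ≤ t → |Θ t| ≤ m) {S : ℝ}
    (hS : 0 ≤ S) (t : ℝ) :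
    |∫ x in (0:ℝ)..1, S * x * (x * (S * x) *
        (Θ (√(S ^ 2 - (S * x) ^ 2 + t ^ 2)) - Θ (√(S ^ 2 - (S * x) ^ 2))))| ≤ m * (2 + t ^ 2 + t ^ 4) := by
  have hm0 : 0 ≤ m := (abs_nonneg _).trans (hm 0 le_rfl)
  have hdiff : ∀ x, |Θ (√(S ^ 2 - (S * x) ^ 2 + t ^ 2)) - Θ (√(S ^ 2 - (S * x) ^ 2))| ≤ m + m := fun x =>
    (abs_sub _ _).trans (add_le_add (hm _ (sqrt_nonneg _)) (hm _ (sqrt_nonneg _)))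
  have hxS : ∀ x : ℝ, |x| ≤ 1 → |x * (S * x)| ≤ S := fun x hx1 => by
    rw [show x * (S * x) = S * (x * x) by ring, abs_mul, abs_of_nonneg hS, abs_mul]
    exact mul_le_of_le_one_right hS (by nlinarith [abs_nonneg x])
  have key : ∀ x ∈ Ioc (0:ℝ) 1, ∀ D K : ℝ, |D| ≤ K → |S * x * (x * (S * x) * D)| ≤ S * (S * K) := by
    intro x hx D K hD
    have hx1 : |x| ≤ 1 := abs_le.2 ⟨by linarith [hx.1], hx.2⟩
    rw [show S * x * (x * (S * x) * D) = S * x * (x * (S * x)) * D by ring, abs_mul, abs_mul, abs_mul,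
      abs_of_nonneg hS, abs_of_nonneg hx.1.le]
    calc S * x * |x * (S * x)| * |D| ≤ S * 1 * S * K :=
          mul_le_mul (mul_le_mul (mul_le_mul_of_nonneg_left hx.2 hS) (hxS x hx1) (abs_nonneg _) (by positivity))
            hD (abs_nonneg _) (by positivity)
      _ = S * (S * K) := by ring
  -- the trivial bound, used for `S ≤ 1`
  have hcrude : |∫ x in (0:ℝ)..1, S * x * (x * (S * x) *
      (Θ (√(S ^ 2 - (S * x) ^ 2 + t ^ 2)) - Θ (√(S ^ 2 - (S * x) ^ 2))))| ≤ S * (S * (m + m)) := by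
    have h := intervalIntegral.norm_integral_le_of_norm_le_const (a := (0:ℝ)) (b := 1) (C := S * (S * (m + m)))
      (f := fun x => S * x * (x * (S * x) *
        (Θ (√(S ^ 2 - (S * x) ^ 2 + t ^ 2)) - Θ (√(S ^ 2 - (S * x) ^ 2))))) fun x hx => by
        rw [uIoc_of_le zero_le_one] at hx
        rw [Real.norm_eq_abs]
        exact key x hx _ _ (hdiff x)
    rw [Real.norm_eq_abs] at h
    simpa using h
  have htail : (0:ℝ) ≤ t ^ 2 + t ^ 4 := by positivity
  rcases le_total S 1 with hS1 | hS1
  · refine hcrude.trans ?_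
    nlinarith [mul_nonneg hm0 (sub_nonneg.2 hS1), mul_nonneg (mul_nonneg hm0 hS) (sub_nonneg.2 hS1)]
  -- `S ≥ 1`: the substitution
  have hS' : 0 < S := by linarith
  have i1 : ∀ c : ℝ, IntervalIntegrable (fun x => S * x * (x * (S * x) * Θ (√(S ^ 2 - (S * x) ^ 2 + c))))
      volume 0 1 := fun c => by
    refine intervalIntegrable_of_abs_le (by fun_prop) (C := S * (S * m)) fun x hx => ?_
    rw [uIoc_of_le zero_le_one] at hx
    exact key x hx _ _ (hm _ (sqrt_nonneg _))
  have i2 : IntervalIntegrable (fun x => S * x * (x * (S * x) * Θ (√(S ^ 2 - (S * x) ^ 2)))) volume 0 1 := by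
    simpa using i1 0
  have e1 : ∫ x in (0:ℝ)..1, S * x * (x * (S * x) * Θ (√(S ^ 2 - (S * x) ^ 2 + t ^ 2))) =
      (2 * S ^ 2)⁻¹ * ∫ y in (t ^ 2)..(S ^ 2 + t ^ 2), (S ^ 2 + t ^ 2 - y) * Θ (√y) := by
    rw [← integral_mul_comp_slice_subst (fun y => (S ^ 2 + t ^ 2 - y) * Θ (√y)) hS' (t ^ 2),
      ← mul_assoc, ← intervalIntegral.integral_const_mul]
    refine intervalIntegral.integral_congr fun x _ => ?_
    field_simp
    ring
  have e2 : ∫ x in (0:ℝ)..1, S * x * (x * (S * x) * Θ (√(S ^ 2 - (S * x) ^ 2))) =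
      (2 * S ^ 2)⁻¹ * ∫ y in (0:ℝ)..(S ^ 2), (S ^ 2 - y) * Θ (√y) := by
    have h := integral_mul_comp_slice_subst (fun y => (S ^ 2 - y) * Θ (√y)) hS' 0
    simp only [add_zero] at h
    rw [← h, ← mul_assoc, ← intervalIntegral.integral_const_mul]
    refine intervalIntegral.integral_congr fun x _ => ?_
    field_simp
    ring
  have hg := intervalIntegrable_comp_sqrt hΘ (m := m) (G := Θ) (fun s hs => (hm s hs).trans (by nlinarith [hm0]))
  have hh := intervalIntegrable_sub_mul_comp_sqrt hΘ hm (S ^ 2)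
  have adj1 := intervalIntegral.integral_add_adjacent_intervals (hh 0 (t ^ 2)) (hh (t ^ 2) (S ^ 2 + t ^ 2))
  have adj2 := intervalIntegral.integral_add_adjacent_intervals (hh 0 (S ^ 2)) (hh (S ^ 2) (S ^ 2 + t ^ 2))
  have hsum : ∫ y in (t ^ 2)..(S ^ 2 + t ^ 2), (S ^ 2 + t ^ 2 - y) * Θ (√y) =
      (∫ y in (t ^ 2)..(S ^ 2 + t ^ 2), (S ^ 2 - y) * Θ (√y)) + t ^ 2 * ∫ y in (t ^ 2)..(S ^ 2 + t ^ 2), Θ (√y) := by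
    rw [← intervalIntegral.integral_const_mul, ← intervalIntegral.integral_add (hh _ _) ((hg _ _).const_mul _)]
    refine intervalIntegral.integral_congr fun y _ => ?_
    ring
  have hB : (∫ x in (0:ℝ)..1, S * x * (x * (S * x) *
        (Θ (√(S ^ 2 - (S * x) ^ 2 + t ^ 2)) - Θ (√(S ^ 2 - (S * x) ^ 2))))) =
      (2 * S ^ 2)⁻¹ * (t ^ 2 * (∫ y in (t ^ 2)..(S ^ 2 + t ^ 2), Θ (√y)) +
        ((∫ y in (S ^ 2)..(S ^ 2 + t ^ 2), (S ^ 2 - y) * Θ (√y)) - ∫ y in (0:ℝ)..(t ^ 2), (S ^ 2 - y) * Θ (√y))) := by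
    have hsub : (∫ x in (0:ℝ)..1, S * x * (x * (S * x) *
        (Θ (√(S ^ 2 - (S * x) ^ 2 + t ^ 2)) - Θ (√(S ^ 2 - (S * x) ^ 2))))) =
        (∫ x in (0:ℝ)..1, S * x * (x * (S * x) * Θ (√(S ^ 2 - (S * x) ^ 2 + t ^ 2)))) -
          ∫ x in (0:ℝ)..1, S * x * (x * (S * x) * Θ (√(S ^ 2 - (S * x) ^ 2))) := by
      rw [← intervalIntegral.integral_sub (i1 _) i2]
      refine intervalIntegral.integral_congr fun x _ => ?_
      ring
    rw [hsub, e1, e2, hsum]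
    linear_combination (2 * S ^ 2)⁻¹ * (adj1 - adj2)
  -- the three windows
  have w1 : |∫ y in (t ^ 2)..(S ^ 2 + t ^ 2), Θ (√y)| ≤ m * S ^ 2 := by
    have h := intervalIntegral.norm_integral_le_of_norm_le_const (a := t ^ 2) (b := S ^ 2 + t ^ 2) (C := m)
      (f := fun y => Θ (√y)) fun y _ => by rw [Real.norm_eq_abs]; exact hm _ (sqrt_nonneg y)
    rwa [Real.norm_eq_abs, show S ^ 2 + t ^ 2 - t ^ 2 = S ^ 2 by ring, abs_of_nonneg (sq_nonneg S)] at h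
  have w2 : |∫ y in (S ^ 2)..(S ^ 2 + t ^ 2), (S ^ 2 - y) * Θ (√y)| ≤ t ^ 2 * m * t ^ 2 := by
    have h := intervalIntegral.norm_integral_le_of_norm_le_const (a := S ^ 2) (b := S ^ 2 + t ^ 2)
      (C := t ^ 2 * m) (f := fun y => (S ^ 2 - y) * Θ (√y)) fun y hy => by
        rw [uIoc_of_le (by nlinarith)] at hy
        rw [Real.norm_eq_abs, abs_mul]
        exact mul_le_mul (abs_le.2 ⟨by linarith [hy.2], by linarith [hy.1, sq_nonneg t]⟩) (hm _ (sqrt_nonneg _))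
          (abs_nonneg _) (sq_nonneg t)
    rwa [Real.norm_eq_abs, add_sub_cancel_left, abs_of_nonneg (sq_nonneg t)] at h
  have w3 : |∫ y in (0:ℝ)..(t ^ 2), (S ^ 2 - y) * Θ (√y)| ≤ (S ^ 2 + t ^ 2) * m * t ^ 2 := by
    have h := intervalIntegral.norm_integral_le_of_norm_le_const (a := (0:ℝ)) (b := t ^ 2)
      (C := (S ^ 2 + t ^ 2) * m) (f := fun y => (S ^ 2 - y) * Θ (√y)) fun y hy => by
        rw [uIoc_of_le (sq_nonneg t)] at hy
        rw [Real.norm_eq_abs, abs_mul]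
        exact mul_le_mul (abs_le.2 ⟨by linarith [hy.2, sq_nonneg S], by linarith [hy.1, sq_nonneg t]⟩)
          (hm _ (sqrt_nonneg _)) (abs_nonneg _) (by positivity)
    rwa [Real.norm_eq_abs, sub_zero, abs_of_nonneg (sq_nonneg t)] at h
  rw [hB, abs_mul, abs_of_pos (by positivity : (0:ℝ) < (2 * S ^ 2)⁻¹)]
  have habs : |t ^ 2 * (∫ y in (t ^ 2)..(S ^ 2 + t ^ 2), Θ (√y)) +
      ((∫ y in (S ^ 2)..(S ^ 2 + t ^ 2), (S ^ 2 - y) * Θ (√y)) - ∫ y in (0:ℝ)..(t ^ 2), (S ^ 2 - y) * Θ (√y))| ≤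
      t ^ 2 * (m * S ^ 2) + (t ^ 2 * m * t ^ 2 + (S ^ 2 + t ^ 2) * m * t ^ 2) := by
    refine (abs_add_le _ _).trans (add_le_add ?_ ((abs_sub _ _).trans (add_le_add w2 w3)))
    rw [abs_mul, abs_of_nonneg (sq_nonneg t)]
    exact mul_le_mul_of_nonneg_left w1 (sq_nonneg t)
  calc (2 * S ^ 2)⁻¹ * |t ^ 2 * (∫ y in (t ^ 2)..(S ^ 2 + t ^ 2), Θ (√y)) +
        ((∫ y in (S ^ 2)..(S ^ 2 + t ^ 2), (S ^ 2 - y) * Θ (√y)) - ∫ y in (0:ℝ)..(t ^ 2), (S ^ 2 - y) * Θ (√y))|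
      ≤ (2 * S ^ 2)⁻¹ * (t ^ 2 * (m * S ^ 2) + (t ^ 2 * m * t ^ 2 + (S ^ 2 + t ^ 2) * m * t ^ 2)) :=
        mul_le_mul_of_nonneg_left habs (by positivity)
    _ ≤ m * (t ^ 2 + t ^ 4) := by
        rw [inv_mul_le_iff₀ (by positivity)]
        have hS2 : 1 ≤ S ^ 2 := by nlinarith
        nlinarith [mul_nonneg (mul_nonneg hm0 (by positivity : (0:ℝ) ≤ t ^ 4)) (sub_nonneg.2 hS2)]
    _ ≤ m * (2 + t ^ 2 + t ^ 4) := by gcongr; linarith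

/-! ### The slice comparison and its Gaussian average -/

/-- **The dipole slice comparison, pointwise in the thermal projection**: for `Θ` measurable with `|Θ| ≤ m` on
`[0, ∞)`, `0 ≤ S` and every `t`, `|J(t) - J(0)| ≤ m ((2 + 4S) + 7S|t| + (3 + (3/2)S) t² + S|t|³ + t⁴)`,
`J(t) = ∫_{-1}^{1} (S x - t)₊ (S - (S x - t) x) Θ(√(S² - (S x)² + t²)) dx` — decomposition `J(t) - J(0) = ∫ g_t`
`+ S ∫ (S x)₊ (Θ_t - Θ₀) - ∫ (S x)₊ x (S x) (Θ_t - Θ₀)`: two flux shifts `g_t = O(|t| m (3S + |t|))` pointwise, the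
radial speed shift (`abs_integral_speedShift_le`) and the cubic speed shift (`abs_integral_cubicSpeedShift_le`). [folklore] -/
theorem abs_dipoleSlice_sub_zero_le (hΘ : Measurable Θ) (hm : ∀ t : ℝ, 0 ≤ t → |Θ t| ≤ m) {S : ℝ}
    (hS : 0 ≤ S) (t : ℝ) :
    |(∫ x in (-1:ℝ)..1, max (S * x - t) 0 * (S - (S * x - t) * x) * Θ (√(S ^ 2 - (S * x) ^ 2 + t ^ 2))) -
        ∫ x in (-1:ℝ)..1, max (S * x) 0 * (S - S * x * x) * Θ (√(S ^ 2 - (S * x) ^ 2))| ≤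
      m * ((2 + 4 * S) + 7 * S * |t| + (3 + 3 / 2 * S) * t ^ 2 + S * |t| ^ 3 + t ^ 4) := by
  have hm0 : 0 ≤ m := (abs_nonneg _).trans (hm 0 le_rfl)
  have hlin : ∀ s : ℝ, 0 ≤ s → |Θ s| ≤ m * (1 + s) := fun s hs => (hm s hs).trans (by nlinarith [hm0])
  have hΘt : ∀ x, |Θ (√(S ^ 2 - (S * x) ^ 2 + t ^ 2))| ≤ m := fun x => hm _ (sqrt_nonneg _)
  have hΘ0 : ∀ x, |Θ (√(S ^ 2 - (S * x) ^ 2))| ≤ m := fun x => hm _ (sqrt_nonneg _)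
  have hdiff : ∀ x, |Θ (√(S ^ 2 - (S * x) ^ 2 + t ^ 2)) - Θ (√(S ^ 2 - (S * x) ^ 2))| ≤ m + m := fun x =>
    (abs_sub _ _).trans (add_le_add (hΘt x) (hΘ0 x))
  have hbd : ∀ s : ℝ, ∀ x ∈ uIoc (-1:ℝ) 1, |x| ≤ 1 ∧ max (S * x - s) 0 ≤ S + |s| ∧ max (S * x) 0 ≤ S ∧ |S * x| ≤ S := by
    intro s x hx
    rw [uIoc_of_le (by norm_num)] at hx
    have hx1 : |x| ≤ 1 := abs_le.2 ⟨hx.1.le, hx.2⟩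
    have hSx : |S * x| ≤ S := by rw [abs_mul, abs_of_nonneg hS]; exact mul_le_of_le_one_right hS hx1
    exact ⟨hx1, max_le (by linarith [(abs_le.1 hSx).2, neg_abs_le s]) (by positivity),
      max_le (abs_le.1 hSx).2 hS, hSx⟩
  -- integrability of the two slices and of the two speed-shift integrands
  have ikt : ∀ s : ℝ, IntervalIntegrable (fun x => max (S * x - s) 0 * (S - (S * x - s) * x) *
      Θ (√(S ^ 2 - (S * x) ^ 2 + s ^ 2))) volume (-1) 1 := fun s => by
    refine intervalIntegrable_of_abs_le (by fun_prop) (C := (S + |s|) * (S + (S + |s|) * 1) * m) fun x hx => ?_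
    obtain ⟨hx1, hmt, -, hSx⟩ := hbd s x hx
    rw [abs_mul, abs_mul, abs_of_nonneg (le_max_right _ _)]
    refine mul_le_mul (mul_le_mul hmt ((abs_sub _ _).trans (add_le_add (abs_of_nonneg hS).le ?_)) (abs_nonneg _)
      (by positivity)) (hm _ (sqrt_nonneg _)) (abs_nonneg _) (by positivity)
    rw [abs_mul]
    exact mul_le_mul ((abs_sub _ _).trans (add_le_add hSx le_rfl)) hx1 (abs_nonneg _) (by positivity)
  have ik0 : IntervalIntegrable (fun x => max (S * x) 0 * (S - S * x * x) * Θ (√(S ^ 2 - (S * x) ^ 2)))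
      volume (-1) 1 := by simpa using ikt 0
  have if2 : IntervalIntegrable (fun x => max (S * x) 0 *
      (Θ (√(S ^ 2 - (S * x) ^ 2 + t ^ 2)) - Θ (√(S ^ 2 - (S * x) ^ 2)))) volume (-1) 1 := by
    refine intervalIntegrable_of_abs_le (by fun_prop) (C := S * (m + m)) fun x hx => ?_
    obtain ⟨-, -, hm0x, -⟩ := hbd t x hx
    rw [abs_mul, abs_of_nonneg (le_max_right _ _)]
    exact mul_le_mul hm0x (hdiff x) (abs_nonneg _) hS
  have if4 : IntervalIntegrable (fun x => max (S * x) 0 * (x * (S * x) *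
      (Θ (√(S ^ 2 - (S * x) ^ 2 + t ^ 2)) - Θ (√(S ^ 2 - (S * x) ^ 2))))) volume (-1) 1 := by
    refine intervalIntegrable_of_abs_le (by fun_prop) (C := S * (1 * S * (m + m))) fun x hx => ?_
    obtain ⟨hx1, -, hm0x, hSx⟩ := hbd t x hx
    rw [abs_mul, abs_of_nonneg (le_max_right _ _), abs_mul, abs_mul]
    exact mul_le_mul hm0x (mul_le_mul (mul_le_mul hx1 hSx (abs_nonneg _) zero_le_one) (hdiff x) (abs_nonneg _)
      (by positivity)) (by positivity) hS
  -- the decomposition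
  have hsplit : (∫ x in (-1:ℝ)..1, max (S * x - t) 0 * (S - (S * x - t) * x) * Θ (√(S ^ 2 - (S * x) ^ 2 + t ^ 2))) -
        (∫ x in (-1:ℝ)..1, max (S * x) 0 * (S - S * x * x) * Θ (√(S ^ 2 - (S * x) ^ 2))) =
      (∫ x in (-1:ℝ)..1, (S * ((max (S * x - t) 0 - max (S * x) 0) * Θ (√(S ^ 2 - (S * x) ^ 2 + t ^ 2))) -
          x * (max (S * x - t) 0 * (S * x - t) - max (S * x) 0 * (S * x)) * Θ (√(S ^ 2 - (S * x) ^ 2 + t ^ 2)))) +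
        (S * (∫ x in (-1:ℝ)..1, max (S * x) 0 *
            (Θ (√(S ^ 2 - (S * x) ^ 2 + t ^ 2)) - Θ (√(S ^ 2 - (S * x) ^ 2)))) -
          ∫ x in (-1:ℝ)..1, max (S * x) 0 * (x * (S * x) *
            (Θ (√(S ^ 2 - (S * x) ^ 2 + t ^ 2)) - Θ (√(S ^ 2 - (S * x) ^ 2))))) := by
    rw [← intervalIntegral.integral_sub (ikt t) ik0, ← intervalIntegral.integral_const_mul,
      ← intervalIntegral.integral_sub (if2.const_mul S) if4, ← sub_eq_iff_eq_add,
      ← intervalIntegral.integral_sub ((ikt t).sub ik0) ((if2.const_mul S).sub if4)]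
    refine intervalIntegral.integral_congr fun x _ => ?_
    ring
  -- the flux shifts, pointwise
  have hflux : |∫ x in (-1:ℝ)..1, (S * ((max (S * x - t) 0 - max (S * x) 0) * Θ (√(S ^ 2 - (S * x) ^ 2 + t ^ 2))) -
      x * (max (S * x - t) 0 * (S * x - t) - max (S * x) 0 * (S * x)) * Θ (√(S ^ 2 - (S * x) ^ 2 + t ^ 2)))| ≤
      2 * (S * (|t| * m) + |t| * (2 * S + |t|) * m) := by
    have h := intervalIntegral.norm_integral_le_of_norm_le_const (a := (-1:ℝ)) (b := 1)
      (C := S * (|t| * m) + |t| * (2 * S + |t|) * m)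
      (f := fun x => S * ((max (S * x - t) 0 - max (S * x) 0) * Θ (√(S ^ 2 - (S * x) ^ 2 + t ^ 2))) -
        x * (max (S * x - t) 0 * (S * x - t) - max (S * x) 0 * (S * x)) * Θ (√(S ^ 2 - (S * x) ^ 2 + t ^ 2)))
      fun x hx => by
        obtain ⟨hx1, -, -, hSx⟩ := hbd t x hx
        rw [Real.norm_eq_abs]
        refine (abs_sub _ _).trans (add_le_add ?_ ?_)
        · rw [abs_mul, abs_of_nonneg hS, abs_mul]
          refine mul_le_mul_of_nonneg_left (mul_le_mul ?_ (hΘt x) (abs_nonneg _) (abs_nonneg _)) hS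
          have h := abs_max_sub_max_le_abs (S * x - t) (S * x) 0
          rwa [show S * x - t - S * x = -t by ring, abs_neg] at h
        · rw [abs_mul, abs_mul]
          calc |x| * |max (S * x - t) 0 * (S * x - t) - max (S * x) 0 * (S * x)| *
                |Θ (√(S ^ 2 - (S * x) ^ 2 + t ^ 2))|
              ≤ 1 * (|t| * (2 * |S * x| + |t|)) * m :=
                mul_le_mul (mul_le_mul hx1 (abs_posPart_mul_sub_le _ _) (abs_nonneg _) zero_le_one) (hΘt x)
                  (abs_nonneg _) (by positivity)
            _ ≤ |t| * (2 * S + |t|) * m := by rw [one_mul]; gcongr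
    rw [Real.norm_eq_abs] at h
    refine h.trans (le_of_eq ?_)
    norm_num
    ring
  rw [hsplit, integral_posPart_mul_eq_integral_Icc hS if4]
  have hT2 := abs_integral_speedShift_le hΘ hlin hS t
  have hT4 := abs_integral_cubicSpeedShift_le hΘ hm hS t
  calc _ ≤ |∫ x in (-1:ℝ)..1, (S * ((max (S * x - t) 0 - max (S * x) 0) * Θ (√(S ^ 2 - (S * x) ^ 2 + t ^ 2))) -
          x * (max (S * x - t) 0 * (S * x - t) - max (S * x) 0 * (S * x)) * Θ (√(S ^ 2 - (S * x) ^ 2 + t ^ 2)))| +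
        (S * |∫ x in (-1:ℝ)..1, max (S * x) 0 * (Θ (√(S ^ 2 - (S * x) ^ 2 + t ^ 2)) - Θ (√(S ^ 2 - (S * x) ^ 2)))| +
          |∫ x in (0:ℝ)..1, S * x * (x * (S * x) *
            (Θ (√(S ^ 2 - (S * x) ^ 2 + t ^ 2)) - Θ (√(S ^ 2 - (S * x) ^ 2))))|) := by
        refine (abs_add_le _ _).trans (add_le_add le_rfl ((abs_sub _ _).trans (add_le_add (le_of_eq ?_) le_rfl)))
        rw [abs_mul, abs_of_nonneg hS]
    _ ≤ 2 * (S * (|t| * m) + |t| * (2 * S + |t|) * m) +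
        (S * (m * (4 + |t| + 3 / 2 * t ^ 2 + |t| ^ 3)) + m * (2 + t ^ 2 + t ^ 4)) := by
        gcongr
    _ = m * ((2 + 4 * S) + 7 * S * |t| + (3 + 3 / 2 * S) * t ^ 2 + S * |t| ^ 3 + t ^ 4) := by
        have h2 : |t| * |t| = t ^ 2 := by rw [← sq, sq_abs]
        linear_combination (2 * m) * h2

/-- The polynomial envelope: `(2 + 4S) + 7S|t| + (3 + (3/2)S)t² + S|t|³ + t⁴ ≤ (2 + (15/2)S) + (3 + (11/2)S)t² + (1 + S/2)t⁴`
(`0 ≤ S`; `2|t| ≤ 1 + t²`, `2|t|³ ≤ t² + t⁴`). [folklore] -/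
theorem dipoleSlice_envelope_le {S : ℝ} (hS : 0 ≤ S) (t : ℝ) :
    (2 + 4 * S) + 7 * S * |t| + (3 + 3 / 2 * S) * t ^ 2 + S * |t| ^ 3 + t ^ 4 ≤
      (2 + 15 / 2 * S) + (3 + 11 / 2 * S) * t ^ 2 + (1 + S / 2) * t ^ 4 := by
  have h2 : t ^ 2 = |t| ^ 2 := (sq_abs t).symm
  have h4 : t ^ 4 = |t| ^ 4 := by rw [show t ^ 4 = (t ^ 2) ^ 2 by ring, h2]; ring
  rw [h2, h4]
  nlinarith [mul_nonneg hS (sq_nonneg (1 - |t|)), mul_nonneg (mul_nonneg hS (sq_nonneg |t|)) (sq_nonneg (1 - |t|)),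
    abs_nonneg t]

/-- **The Gaussian moments of the envelope**: `∫ m((2 + (15/2)S) + (3 + (11/2)S)t² + (1 + S/2)t⁴) dγ(t) = m (8 + (29/2) S)`
(`∫ t² dγ = 1`, `∫ t⁴ dγ = 3`), with its integrability. [folklore] -/
theorem integral_dipoleSlice_envelope (m S : ℝ) :
    Integrable (fun t : ℝ => m * ((2 + 15 / 2 * S) + (3 + 11 / 2 * S) * t ^ 2 + (1 + S / 2) * t ^ 4)) (gaussianReal 0 1) ∧
      ∫ t, m * ((2 + 15 / 2 * S) + (3 + 11 / 2 * S) * t ^ 2 + (1 + S / 2) * t ^ 4) ∂gaussianReal 0 1 =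
        m * (8 + 29 / 2 * S) := by
  have i2 : Integrable (fun t : ℝ => t ^ 2) (gaussianReal 0 1) := integrable_pow_gaussianReal 0 1 2
  have i4 : Integrable (fun t : ℝ => t ^ 4) (gaussianReal 0 1) := integrable_pow_gaussianReal 0 1 4
  have v2 : ∫ t : ℝ, t ^ 2 ∂gaussianReal 0 1 = 1 := by
    have h := integral_pow_even_gaussianReal_one 1
    norm_num [Nat.doubleFactorial] at h
    exact h
  have v4 : ∫ t : ℝ, t ^ 4 ∂gaussianReal 0 1 = 3 := by
    have h := integral_pow_even_gaussianReal_one 2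
    norm_num [Nat.doubleFactorial] at h
    exact h
  have ia : Integrable (fun t : ℝ => (2 + 15 / 2 * S) + (3 + 11 / 2 * S) * t ^ 2) (gaussianReal 0 1) :=
    (integrable_const _).add (i2.const_mul _)
  have ib : Integrable (fun t : ℝ => (1 + S / 2) * t ^ 4) (gaussianReal 0 1) := i4.const_mul _
  refine ⟨(ia.add ib).const_mul m, ?_⟩
  rw [integral_const_mul, integral_add ia ib, integral_const_mul, integral_add (integrable_const _) (i2.const_mul _),
    integral_const_mul, integral_const, v2, v4, probReal_univ, one_smul]
  ring

/-- **(e-K₂) on dipole fields**: for `a ∈ ℝ³`, `Θ : ℝ → ℝ` measurable with `|Θ t| ≤ m` on `[0, ∞)` and every `v ∈ ℝ³`,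
`|gainTerm (⟪a, ·⟫ Θ(‖·‖)) v - lorentzGain (⟪a, ·⟫ Θ(‖·‖)) v| ≤ 2π m ‖a‖ (16 + 29‖v‖)` — the slice form
`4π⟪a, n⟫ ∫ γ(dt) (J(t) - J(0))`, `|⟪a, n⟫| ≤ ‖a‖`, the pointwise slice comparison and the Gaussian moments of its
envelope. [folklore] -/
theorem abs_gainTerm_dipole_sub_lorentzGain_le (a : EuclideanSpace ℝ (Fin 3)) (hΘ : Measurable Θ)
    (hm : ∀ t : ℝ, 0 ≤ t → |Θ t| ≤ m) (v : EuclideanSpace ℝ (Fin 3)) :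
    |gainTerm (fun x => ⟪a, x⟫_ℝ * Θ ‖x‖) v - lorentzGain (fun x => ⟪a, x⟫_ℝ * Θ ‖x‖) v| ≤
      2 * π * m * ‖a‖ * (16 + 29 * ‖v‖) := by
  have hm0 : 0 ≤ m := (abs_nonneg _).trans (hm 0 le_rfl)
  obtain ⟨n, hn, hvn⟩ := exists_unit_inner_eq v
  obtain ⟨hg, hgi⟩ := integral_dipoleSlice_envelope m ‖v‖
  have han : |⟪a, n⟫_ℝ| ≤ ‖a‖ := by
    have h := abs_real_inner_le_norm a n
    rwa [hn, mul_one] at h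
  have hpt : ∀ t, |(∫ x in (-1:ℝ)..1,
      max (‖v‖ * x - t) 0 * (‖v‖ - (‖v‖ * x - t) * x) * Θ (√(‖v‖ ^ 2 - (‖v‖ * x) ^ 2 + t ^ 2))) -
        ∫ x in (-1:ℝ)..1, max (‖v‖ * x) 0 * (‖v‖ - ‖v‖ * x * x) * Θ (√(‖v‖ ^ 2 - (‖v‖ * x) ^ 2))| ≤
      m * ((2 + 15 / 2 * ‖v‖) + (3 + 11 / 2 * ‖v‖) * t ^ 2 + (1 + ‖v‖ / 2) * t ^ 4) :=
    fun t => (abs_dipoleSlice_sub_zero_le hΘ hm (norm_nonneg v) t).trans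
      (mul_le_mul_of_nonneg_left (dipoleSlice_envelope_le (norm_nonneg v) t) hm0)
  rw [gainTerm_sub_lorentzGain_dipole_eq a hΘ hm hn hvn, abs_mul, abs_mul, abs_of_pos (by positivity : (0:ℝ) < 4 * π)]
  calc 4 * π * |⟪a, n⟫_ℝ| * |∫ t, ((∫ x in (-1:ℝ)..1,
          max (‖v‖ * x - t) 0 * (‖v‖ - (‖v‖ * x - t) * x) * Θ (√(‖v‖ ^ 2 - (‖v‖ * x) ^ 2 + t ^ 2))) -
        ∫ x in (-1:ℝ)..1, max (‖v‖ * x) 0 * (‖v‖ - ‖v‖ * x * x) * Θ (√(‖v‖ ^ 2 - (‖v‖ * x) ^ 2))) ∂gaussianReal 0 1|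
      ≤ 4 * π * ‖a‖ * ∫ t, m * ((2 + 15 / 2 * ‖v‖) + (3 + 11 / 2 * ‖v‖) * t ^ 2 + (1 + ‖v‖ / 2) * t ^ 4)
          ∂gaussianReal 0 1 := by
        refine mul_le_mul (by gcongr) ?_ (abs_nonneg _) (by positivity)
        rw [← Real.norm_eq_abs]
        exact norm_integral_le_of_norm_le hg (Eventually.of_forall fun t => by rw [Real.norm_eq_abs]; exact hpt t)
    _ = 2 * π * m * ‖a‖ * (16 + 29 * ‖v‖) := by rw [hgi]; ring

/-! ### Registered helper -/

/-- **Registered helper `t12_gainTerm_dipole_sub_lorentz` — (e-K₂) on the DIPOLE sector: the true gain term of the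
linearised hard-sphere operator on a dipole field against its far-field (Lorentz) limit, for a merely measurable
bounded amplitude.** For `a ∈ ℝ³`, `Θ : ℝ → ℝ` measurable with `|Θ t| ≤ m` for `t ≥ 0` (no continuity, no bounded
variation), `u(x) = ⟪a, x⟫ Θ(‖x‖)` and every `v ∈ ℝ³` (`M = stdGaussian`, `σ` the surface measure of `S²`,
`(v', w') = collide ω (v, w)`, `lorentzGain` the partner-at-rest operator of `…T12Lorentz`):
`|∫ dM(w) ∫_{S²} ((v-w)·ω)₊ u(v') dσ + ∫ dM(w) ∫_{S²} ((v-w)·ω)₊ u(w') dσ - lorentzGain u v| ≤ 2π m ‖a‖ (16 + 29‖v‖)`,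
i.e. `|gainTerm u v - lorentzGain u v| = O(m ‖a‖ (1 + ‖v‖))` ABSOLUTE, `O(1/‖v‖)` RELATIVE to the main terms
`≍ m ‖a‖ ‖v‖²` (`lorentzGain u (S n) = (4π/S²)⟪a, n⟫∫₀^S r³ Θ(r) dr`, `lorentzGain_dipole_eq_slice`) — the order
consumed by (e-K₂) on the `ℓ = 1` sector of the corrector-growth plan (the defect `γ` of the Euler–Volterra modulus
`t12_euler_dipole_logModulus`). Mechanism (`…T12GainDipole`): exchange symmetry + Carleman's slice (flux, speed AND
`⟪a, v'⟫ depend on the partner only through `t = ⟪w, ω⟫ ∼ N(0,1)`) + hat-box + Funk–Hecke for `P₁` give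
`gainTerm u v - lorentzGain u v = 4π⟪a, n⟫ ∫ γ(dt) (J(t) - J(0))`, `J(t) = ∫_{-1}^{1} (Sx - t)₊ (S - (Sx - t)x) Θ(√(S² - (Sx)² + t²)) dx`,
`S = ‖v‖`, `v = S n`; then two flux shifts (`1`-Lipschitz), the radial speed shift of `…T12GainRadialGeneralB` times
`S`, and the cubic speed shift — the substitution `y = S² - (Sx)² + t²` turns `∫₀¹ Sx (Sx)² Θ_t` into
`(2S)⁻¹∫_{t²}^{S²+t²} (S² + t² - y) Θ(√y) dy`, an `O(t²)` window displacement plus an `O(t²)` weight defect — give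
`|J(t) - J(0)| ≤ m((2 + 4S) + 7S|t| + (3 + (3/2)S)t² + S|t|³ + t⁴)`, and `∫ t² dγ = 1`, `∫ t⁴ dγ = 3`. [folklore] -/
theorem t12_gainTerm_dipole_sub_lorentz : ∀ (a : EuclideanSpace ℝ (Fin 3)) (Θ : ℝ → ℝ) (m : ℝ), Measurable Θ → (∀ t : ℝ, 0 ≤ t → |Θ t| ≤ m) → ∀ v : EuclideanSpace ℝ (Fin 3), |Summit.AtomisticToContinuum.HydrodynamicLimit.Theorems.ClampedCorrectorBirth.gainTerm (fun x : EuclideanSpace ℝ (Fin 3) => inner ℝ a x * Θ ‖x‖) v - Summit.AtomisticToContinuum.HydrodynamicLimit.Theorems.ClampedCorrectorBirth.lorentzGain (fun x : EuclideanSpace ℝ (Fin 3) => inner ℝ a x * Θ ‖x‖) v| ≤ 2 * Real.pi * m * ‖a‖ * (16 + 29 * ‖v‖) :=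
  fun a _ _ hΘ hm v => abs_gainTerm_dipole_sub_lorentzGain_le a hΘ hm v

end Summit.AtomisticToContinuum.HydrodynamicLimit.Theorems.ClampedCorrectorBirth

end
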